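import Summits.CriticalPhenomena.PercolationContinuityZ3.Theorems.Transplant.PlanarSkeletonFrmFromDefs
import Summits.CriticalPhenomena.PercolationContinuityZ3.Theorems.Transplant.SkelFrmFromBChoiceResidF
import Summits.CriticalPhenomena.PercolationContinuityZ3.Theorems.Transplant.SkelFrmBChoiceResidF
import Summits.CriticalPhenomena.PercolationContinuityZ3.Theorems.Transplant.SkelFrmFromBParamsFaceBandAR0
import Summits.CriticalPhenomena.PercolationContinuityZ3.Theorems.Transplant.SkelFrmBParamsFaceBandAR0
import Summits.CriticalPhenomena.PercolationContinuityZ3.Theorems.Transplant.SkelFrmFromBParamsFaceBandA2R0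
import Summits.CriticalPhenomena.PercolationContinuityZ3.Theorems.Transplant.SkelFrmBParamsFaceBandA2R0
import Summits.CriticalPhenomena.PercolationContinuityZ3.Theorems.Transplant.SkelFrmFromBParamsFaceLamA
import Summits.CriticalPhenomena.PercolationContinuityZ3.Theorems.Transplant.SkelFrmBParamsFaceLamA
import Summits.CriticalPhenomena.PercolationContinuityZ3.Theorems.Transplant.SkelFrmFromBParamsFaceCountsRangeA
import Summits.CriticalPhenomena.PercolationContinuityZ3.Theorems.Transplant.SkelFrmBParamsFaceCountsRangeA
import HarnessLib
import Summits.CriticalPhenomena.PercolationContinuityZ3.Theorems.Transplant.SkelFrmBParamsFaceFloorsHypsF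
/-!
# U-WAVE PORT (RULING D-U, lead g21 2026-08-26; WAVE-U-MANIFEST v3.1 row «SkelFrmBParamsFaceFloorsHypsF» ↦ «SkelFrmFromBParamsFaceFloorsHypsF») of the tree module
# `Transplant/SkelFrmBParamsFaceFloorsHypsF` onto the carrier `PlanarSkeletonFrmFrom` (frames only, cylinders connected from width `ℓ₀` on)

ORIGINAL TITLE: N2 (frames-only node, OPEN) — (F) column, DISCHARGE LAYER part 1: **THE STANDARD HYPOTHESES OF THE TWO FACE ASSEMBLIES AT ANY DOMINATING SLOT VALUE**

builds on p205010 (kernel theorem, internal audit signed; external expert review pending) — nothing in this file uses p205010; NOTHING is claimed about the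
OPEN node U `SamePDropOfSkeletonFrmFrom₁` (nor U_s / the end state).  Lane `prim-bschramm`, seat `prim-bschramm-stmt` gen 26 (port pen, RULING M-11 family P-stmt; tool = p3-g26's port_u.py of record, registry-driven inputs); helper file
(`--supports stmt-CriticalPhenomena-4575 --as helper`).  PORT RULES r1–r4 of RULING D-U: declaration order and proof texts are those of the original,
byte-identical except (i) the carrier token `PlanarSkeletonFrm ↦ PlanarSkeletonFrmFrom` (binders, `namespace`/`end` lines, qualified names of twinned
declarations), (ii) carrier-FREE declarations of the original (φ-level `Skelφ…` blocks and namespace-only arithmetic residents) are NOT re-declared —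
this file imports the original and `export`s the twin-free residents (POLICY T / treatment (m1)); residents whose statement mentions a twinned
constant are copied, (iii) every carrier-binding declaration keeps its explicit binder `(Φ : PlanarSkeletonFrmFrom G)` in its own signature (r2).  Docstrings and citations are the original's.
-/

noncomputable section

open scoped Classical

namespace Summit.CriticalPhenomena.PercolationContinuityZ3.Theorems.Transplant

namespace PlanarSkeletonFrmFrom

namespace NegB

namespace KS

open Literature.Probability.Percolation Literature.Probability.LatticeModels SimpleGraph
open Literature.Probability.Percolation.KozmaNitzan.Cells (oth)
open SkelConc (Consts)
open Skelφ.StepI (DataNS)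
open Neg

section Hyps

variable (κ : Consts) {V : Type} [DecidableEq V] [Countable V] {G : SimpleGraph V} [G.LocallyFinite] (Φ : PlanarSkeletonFrmFrom G) (t : V) (p : unitInterval)
  (D : DataNS V) (c mk : ℕ) (gx fx : Neg.FSlot)

/-- **The slot floors of the (F) assemblies** at any `(gx, fx) ⊒ (gxFc mk c, fxFc mk)`: `hnA`, `hnA24`, `hℓA`, `hS`, `hS64`, `hMR0`, `hMR0K`, `hRn0`. [folklore] -/
theorem slotsF_hyps (κ : Consts) {V : Type} [DecidableEq V] [Countable V] {G : SimpleGraph V} [G.LocallyFinite] (Φ : PlanarSkeletonFrmFrom G) (t : V) (p : unitInterval) (D : DataNS V) (c : ℕ) (mk : ℕ) (gx : Neg.FSlot) (fx : Neg.FSlot) (hgx : ∀ D : DataNS V, gxFc mk c κ Φ t p D ≤ gx κ Φ t p D) (hfx : ∀ D : DataNS V, fxFc mk κ Φ t p D ≤ fx κ Φ t p D)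
    (hN : EqNumL κ Φ t p D (gT mk gx κ Φ t p D) (fT mk fx κ Φ t p D)) :
    2000 * Neg.Kq κ * (KS0.R'0 κ Φ t p D mk + 2) ≤ nL κ Φ t p D (gT mk gx κ Φ t p D) (fT mk fx κ Φ t p D) ∧
    2400 * Neg.Kq κ * (KS0.R'0 κ Φ t p D mk + 2) ≤ nL κ Φ t p D (gT mk gx κ Φ t p D) (fT mk fx κ Φ t p D) ∧
    22000 * Neg.Kq κ * (KS0.R'0 κ Φ t p D mk + 2) ≤ ℓL κ Φ t p D (gT mk gx κ Φ t p D) (fT mk fx κ Φ t p D) ∧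
    16 * SF κ Φ t p D c mk ≤ ML κ Φ t p D (gT mk gx κ Φ t p D) ∧ 64 * SF κ Φ t p D c mk ≤ ML κ Φ t p D (gT mk gx κ Φ t p D) ∧
    22000 * (KS0.R'0 κ Φ t p D mk + 2) ≤ ML κ Φ t p D (gT mk gx κ Φ t p D) ∧
    22000 * Neg.Kq κ * (KS0.R'0 κ Φ t p D mk + 2) ≤ ML κ Φ t p D (gT mk gx κ Φ t p D) ∧
    KS0.R'0 κ Φ t p D mk ≤ nL κ Φ t p D (gT mk gx κ Φ t p D) (fT mk fx κ Φ t p D) :=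
  ⟨hnAF_of_ge hfx D _, hnA24_of_ge hfx D _, hℓAF_of_ge hgx D hN, hS_of_ge hgx D, hS64_of_ge hgx D, (hR0F_of_ge hgx D).2,
    (hR0F_of_ge hgx D).1, hRn0F_of_ge hfx D _⟩

/-- **The cell-unit rows and the zone bounds**: `6R'0+11 ≤ u₀A`, `14R'0+27 ≤ u₁A`, `2 ≤ u₁A`, `kF₀A ≤ 8u₀A + 1`, `kF₁A ≤ 8u₁A + 1`. [folklore] -/
theorem cellsF_hyps (κ : Consts) {V : Type} [DecidableEq V] [Countable V] {G : SimpleGraph V} [G.LocallyFinite] (Φ : PlanarSkeletonFrmFrom G) (t : V) (p : unitInterval) (D : DataNS V) (c : ℕ) (mk : ℕ) (gx : Neg.FSlot) (fx : Neg.FSlot) (hgx : ∀ D : DataNS V, gxFc mk c κ Φ t p D ≤ gx κ Φ t p D)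
    (hN : EqNumL κ Φ t p D (gT mk gx κ Φ t p D) (fT mk fx κ Φ t p D))
    (hκ : (hL κ Φ t p D (gT mk gx κ Φ t p D) (fT mk fx κ Φ t p D)).natAbs ≤ 10 * nL κ Φ t p D (gT mk gx κ Φ t p D) (fT mk fx κ Φ t p D)) :
    6 * (KS0.R'0 κ Φ t p D mk : ℤ) + 11 ≤ u₀A κ Φ t p D (gT mk gx κ Φ t p D) (fT mk fx κ Φ t p D) ∧
    14 * (KS0.R'0 κ Φ t p D mk : ℤ) + 27 ≤ u₁A κ Φ t p D (gT mk gx κ Φ t p D) (fT mk fx κ Φ t p D) ∧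
    2 ≤ u₁A κ Φ t p D (gT mk gx κ Φ t p D) (fT mk fx κ Φ t p D) ∧
    kF₀A κ Φ t p D c mk (gT mk gx κ Φ t p D) (fT mk fx κ Φ t p D) ≤ 8 * u₀A κ Φ t p D (gT mk gx κ Φ t p D) (fT mk fx κ Φ t p D) + 1 ∧
    kF₁A κ Φ t p D c mk (gT mk gx κ Φ t p D) (fT mk fx κ Φ t p D) ≤ 8 * u₁A κ Φ t p D (gT mk gx κ Φ t p D) (fT mk fx κ Φ t p D) + 1 := by
  obtain ⟨hMR0K, hMR0⟩ := hR0F_of_ge hgx D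
  have hS := hS_of_ge hgx D
  obtain ⟨h4K, -⟩ := ML_floorR0_of_Kq κ Φ t p D (gT mk gx κ Φ t p D) mk hMR0K
  obtain ⟨hs0, hs1⟩ := cells_geR0A κ Φ t p D (gT mk gx κ Φ t p D) (fT mk fx κ Φ t p D) mk hN hκ h4K
  obtain ⟨hk0, hk1⟩ := kFA_le κ Φ t p D c mk gx (fT mk fx κ Φ t p D) hN hκ hMR0 hS
  have hR : (0 : ℤ) ≤ (KS0.R'0 κ Φ t p D mk : ℤ) := by positivity
  refine ⟨hs0, hs1, ?_, hk0, hk1⟩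
  show (2 : ℤ) ≤ (((fcellsA κ Φ t p D (gT mk gx κ Φ t p D) (fT mk fx κ Φ t p D)).s 1 : ℕ) : ℤ)
  linarith

/-- **The face band `E := Rlev0 + reach0`**: `E ≤ 2·R'0` (indeed `E = R'0 − 1 + reach0 ≤ 2R'0 − 2`), `E − 1 ≤ 2·R'0`, and `E ≤ u₀A`, `E ≤ u₁A` under the
cell-unit rows. [folklore] -/
theorem bandF_facts (κ : Consts) {V : Type} [DecidableEq V] [Countable V] {G : SimpleGraph V} [G.LocallyFinite] (Φ : PlanarSkeletonFrmFrom G) (t : V) (p : unitInterval) (D : DataNS V) (c : ℕ) (mk : ℕ) (gx : Neg.FSlot) (fx : Neg.FSlot) (hgx : ∀ D : DataNS V, gxFc mk c κ Φ t p D ≤ gx κ Φ t p D)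
    (hN : EqNumL κ Φ t p D (gT mk gx κ Φ t p D) (fT mk fx κ Φ t p D))
    (hκ : (hL κ Φ t p D (gT mk gx κ Φ t p D) (fT mk fx κ Φ t p D)).natAbs ≤ 10 * nL κ Φ t p D (gT mk gx κ Φ t p D) (fT mk fx κ Φ t p D)) :
    (((KS0.Rlev0 κ Φ t p D mk + KS0.reach0 t D mk : ℕ) : ℤ) ≤ 2 * (KS0.R'0 κ Φ t p D mk : ℤ)) ∧
    KS0.Rlev0 κ Φ t p D mk + KS0.reach0 t D mk - 1 ≤ 2 * KS0.R'0 κ Φ t p D mk ∧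
    ((KS0.Rlev0 κ Φ t p D mk + KS0.reach0 t D mk : ℕ) : ℤ) ≤ u₀A κ Φ t p D (gT mk gx κ Φ t p D) (fT mk fx κ Φ t p D) ∧
    ((KS0.Rlev0 κ Φ t p D mk + KS0.reach0 t D mk : ℕ) : ℤ) ≤ u₁A κ Φ t p D (gT mk gx κ Φ t p D) (fT mk fx κ Φ t p D) := by
  obtain ⟨h1, h2, -⟩ := KS0.R'0_eq κ Φ t p D mk
  have hE : KS0.Rlev0 κ Φ t p D mk + KS0.reach0 t D mk ≤ 2 * KS0.R'0 κ Φ t p D mk := by omega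
  have hE' : ((KS0.Rlev0 κ Φ t p D mk + KS0.reach0 t D mk : ℕ) : ℤ) ≤ 2 * (KS0.R'0 κ Φ t p D mk : ℤ) := by exact_mod_cast hE
  obtain ⟨hs0, hs1, -⟩ := cellsF_hyps κ Φ t p D c mk gx fx hgx hN hκ
  have hR : (0 : ℤ) ≤ (KS0.R'0 κ Φ t p D mk : ℤ) := by positivity
  exact ⟨hE', kit0Rl_le κ Φ t p D mk, by linarith, by linarith⟩

/-- **The x-face band rows** at `kE := kFF₂ (E−1) 0` (transverse axis `1 = oth 0`, creep `P.c 0`), generic staggered cells over `fcellsA`; the creep cap and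
the per-axis cap are hypotheses in stmt's proved shapes. [cite: KozmaNitzan2024, §4 Lemma 12 (pp. 23–25)] -/
theorem bandX_hyps (κ : Consts) {V : Type} [DecidableEq V] [Countable V] {G : SimpleGraph V} [G.LocallyFinite] (Φ : PlanarSkeletonFrmFrom G) (t : V) (p : unitInterval) (D : DataNS V) (c : ℕ) (mk : ℕ) (gx : Neg.FSlot) (fx : Neg.FSlot) (hgx : ∀ D : DataNS V, gxFc mk c κ Φ t p D ≤ gx κ Φ t p D)
    (hN : EqNumL κ Φ t p D (gT mk gx κ Φ t p D) (fT mk fx κ Φ t p D))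
    (hκ : (hL κ Φ t p D (gT mk gx κ Φ t p D) (fT mk fx κ Φ t p D)).natAbs ≤ 10 * nL κ Φ t p D (gT mk gx κ Φ t p D) (fT mk fx κ Φ t p D))
    (hKq : 2 ≤ Neg.Kq κ) (P : PCells2T) (hP : P.toPCells2 = fcellsA κ Φ t p D (gT mk gx κ Φ t p D) (fT mk fx κ Φ t p D))
    (hc0 : (P.c 0 : ℤ) ≤ 19 * u₁A κ Φ t p D (gT mk gx κ Φ t p D) (fT mk fx κ Φ t p D) + 1) (hcr0 : (P.c 0 : ℤ) ≤ (P.r 1 : ℤ)) :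
    (prFA κ Φ t p D (gT mk gx κ Φ t p D) (fT mk fx κ Φ t p D)).kFF₂ (fcellsA κ Φ t p D (gT mk gx κ Φ t p D) (fT mk fx κ Φ t p D))
        (KS0.Rlev0 κ Φ t p D mk + KS0.reach0 t D mk - 1) 0 ≤ 5 * (P.r 1 : ℤ) ∧
    (prFA κ Φ t p D (gT mk gx κ Φ t p D) (fT mk fx κ Φ t p D)).kFF₂ (fcellsA κ Φ t p D (gT mk gx κ Φ t p D) (fT mk fx κ Φ t p D))
        (KS0.Rlev0 κ Φ t p D mk + KS0.reach0 t D mk - 1) 0 + 8 * u₁A κ Φ t p D (gT mk gx κ Φ t p D) (fT mk fx κ Φ t p D) + 8 + P.c 0 ≤ 5 * (P.r 1 : ℤ) ∧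
    2 * (prFA κ Φ t p D (gT mk gx κ Φ t p D) (fT mk fx κ Φ t p D)).kFF₂ (fcellsA κ Φ t p D (gT mk gx κ Φ t p D) (fT mk fx κ Φ t p D))
        (KS0.Rlev0 κ Φ t p D mk + KS0.reach0 t D mk - 1) 0 + 8 * u₁A κ Φ t p D (gT mk gx κ Φ t p D) (fT mk fx κ Φ t p D) + 8 + 2 * (P.c 0 : ℤ) ≤
      5 * (P.r 1 : ℤ) := by
  obtain ⟨hMR0K, -⟩ := hR0F_of_ge hgx D
  obtain ⟨h4K, -⟩ := ML_floorR0_of_Kq κ Φ t p D (gT mk gx κ Φ t p D) mk hMR0K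
  have huf := uA_oth_factsR0 κ Φ t p D (fT mk fx κ Φ t p D) mk gx hN hκ h4K 0
  obtain ⟨-, hs1, -, -, -⟩ := cellsF_hyps κ Φ t p D c mk gx fx hgx hN hκ
  obtain ⟨hrP, -, -⟩ := cells_of_hP κ Φ t p D (gT mk gx κ Φ t p D) (fT mk fx κ Φ t p D) P hP
  have hRl := kit0Rl_le κ Φ t p D mk
  have h8 := hkE8_R0₄ κ Φ t p D (fT mk fx κ Φ t p D) mk gx hN hκ hRl 0 huf.2.1
  have hlin := kFF₂_le_linA κ Φ t p D (fT mk fx κ Φ t p D) mk gx hN hκ (KS0.Rlev0 κ Φ t p D mk + KS0.reach0 t D mk - 1) 0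
  obtain ⟨hr1, hu, hru⟩ := huf
  simp only [show oth (0 : Fin 2) = 1 from rfl, show ((1 : Fin 2) = 0) = False from propext ⟨fun h => absurd h (by decide), False.elim⟩,
    if_false] at hr1 hu hru h8 hlin
  rw [hrP 1]
  have hRl' : ((KS0.Rlev0 κ Φ t p D mk + KS0.reach0 t D mk - 1 : ℕ) : ℤ) ≤ 2 * (KS0.R'0 κ Φ t p D mk : ℤ) := by exact_mod_cast hRl
  have hKq' : (2 : ℤ) ≤ (Neg.Kq κ : ℤ) := by exact_mod_cast hKq
  have hR : (0 : ℤ) ≤ (KS0.R'0 κ Φ t p D mk : ℤ) := by positivity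
  have hc' : (P.c 0 : ℤ) ≤ ((fcellsA κ Φ t p D (gT mk gx κ Φ t p D) (fT mk fx κ Φ t p D)).r 1 : ℤ) := by rw [← hrP 1]; exact hcr0
  have hc0' : (0 : ℤ) ≤ P.c 0 := P.c_nonneg 0
  refine ⟨by linarith, by linarith, ?_⟩
  nlinarith

/-- **The y′-face band rows** at `kE := kFF₂ (E−1) 1` (transverse axis `0 = oth 1`, creep `P.c 1`), with the proved cap shape `2·c₁ ≤ 115·u₀A + 1` and
`Kq ≥ 6` (⟸ `Kmin = 200`). [cite: KozmaNitzan2024, §4 Lemma 12 (pp. 23–25)] -/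
theorem bandY_hyps (κ : Consts) {V : Type} [DecidableEq V] [Countable V] {G : SimpleGraph V} [G.LocallyFinite] (Φ : PlanarSkeletonFrmFrom G) (t : V) (p : unitInterval) (D : DataNS V) (c : ℕ) (mk : ℕ) (gx : Neg.FSlot) (fx : Neg.FSlot) (hgx : ∀ D : DataNS V, gxFc mk c κ Φ t p D ≤ gx κ Φ t p D)
    (hN : EqNumL κ Φ t p D (gT mk gx κ Φ t p D) (fT mk fx κ Φ t p D))
    (hκ : (hL κ Φ t p D (gT mk gx κ Φ t p D) (fT mk fx κ Φ t p D)).natAbs ≤ 10 * nL κ Φ t p D (gT mk gx κ Φ t p D) (fT mk fx κ Φ t p D))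
    (hKq : 6 ≤ Neg.Kq κ) (P : PCells2T) (hP : P.toPCells2 = fcellsA κ Φ t p D (gT mk gx κ Φ t p D) (fT mk fx κ Φ t p D))
    (hc1 : 2 * (P.c 1 : ℤ) ≤ 115 * u₀A κ Φ t p D (gT mk gx κ Φ t p D) (fT mk fx κ Φ t p D) + 1) (hcr1 : (P.c 1 : ℤ) ≤ (P.r 0 : ℤ)) :
    (prFA κ Φ t p D (gT mk gx κ Φ t p D) (fT mk fx κ Φ t p D)).kFF₂ (fcellsA κ Φ t p D (gT mk gx κ Φ t p D) (fT mk fx κ Φ t p D))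
        (KS0.Rlev0 κ Φ t p D mk + KS0.reach0 t D mk - 1) 1 ≤ 5 * (P.r 0 : ℤ) ∧
    (prFA κ Φ t p D (gT mk gx κ Φ t p D) (fT mk fx κ Φ t p D)).kFF₂ (fcellsA κ Φ t p D (gT mk gx κ Φ t p D) (fT mk fx κ Φ t p D))
        (KS0.Rlev0 κ Φ t p D mk + KS0.reach0 t D mk - 1) 1 + 8 * u₀A κ Φ t p D (gT mk gx κ Φ t p D) (fT mk fx κ Φ t p D) + 8 + P.c 1 ≤ 5 * (P.r 0 : ℤ) ∧
    2 * (prFA κ Φ t p D (gT mk gx κ Φ t p D) (fT mk fx κ Φ t p D)).kFF₂ (fcellsA κ Φ t p D (gT mk gx κ Φ t p D) (fT mk fx κ Φ t p D))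
        (KS0.Rlev0 κ Φ t p D mk + KS0.reach0 t D mk - 1) 1 + 24 * u₀A κ Φ t p D (gT mk gx κ Φ t p D) (fT mk fx κ Φ t p D) + 24 + 2 * (P.c 1 : ℤ) ≤
      5 * (P.r 0 : ℤ) := by
  obtain ⟨hMR0K, -⟩ := hR0F_of_ge hgx D
  obtain ⟨h4K, -⟩ := ML_floorR0_of_Kq κ Φ t p D (gT mk gx κ Φ t p D) mk hMR0K
  have huf := uA_oth_factsR0 κ Φ t p D (fT mk fx κ Φ t p D) mk gx hN hκ h4K 1
  obtain ⟨hrP, -, -⟩ := cells_of_hP κ Φ t p D (gT mk gx κ Φ t p D) (fT mk fx κ Φ t p D) P hP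
  have hRl := kit0Rl_le κ Φ t p D mk
  have h8 := hkE8_R0₄ κ Φ t p D (fT mk fx κ Φ t p D) mk gx hN hκ hRl 1 huf.2.1
  have hlin := kFF₂_le_linA κ Φ t p D (fT mk fx κ Φ t p D) mk gx hN hκ (KS0.Rlev0 κ Φ t p D mk + KS0.reach0 t D mk - 1) 1
  obtain ⟨hr0, hu, hru⟩ := huf
  simp only [show oth (1 : Fin 2) = 0 from rfl, if_true] at hr0 hu hru h8 hlin
  rw [hrP 0]
  have hRl' : ((KS0.Rlev0 κ Φ t p D mk + KS0.reach0 t D mk - 1 : ℕ) : ℤ) ≤ 2 * (KS0.R'0 κ Φ t p D mk : ℤ) := by exact_mod_cast hRl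
  have hKq' : (6 : ℤ) ≤ (Neg.Kq κ : ℤ) := by exact_mod_cast hKq
  have hR : (0 : ℤ) ≤ (KS0.R'0 κ Φ t p D mk : ℤ) := by positivity
  have hc' : (P.c 1 : ℤ) ≤ ((fcellsA κ Φ t p D (gT mk gx κ Φ t p D) (fT mk fx κ Φ t p D)).r 0 : ℤ) := by rw [← hrP 0]; exact hcr1
  have hc0' : (0 : ℤ) ≤ P.c 1 := P.c_nonneg 1
  refine ⟨by linarith, by linarith, ?_⟩
  nlinarith

end Hyps

end KS

end NegB

end PlanarSkeletonFrmFrom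

end Summit.CriticalPhenomena.PercolationContinuityZ3.Theorems.Transplant

end
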